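import Summits.NavierStokesRegularity.NavierStokesRegularity.Theorems.SoloSalvageWu2026HarmonicCutoff
import Literature.Analysis.FluidPDE.HarmonicProbe
import Literature.Analysis.FluidPDE.ClassicalSolutionCalculus
import HarnessLib

/-!
# C177 `Wu2026` — tools for sub-binder (C) of `Step_construct`: the rescaled steady system
# (3.50) of the blow-down and its tested identities (cell `pub/ns-inputs`, seat `ns-in-wu-con`;
# route business of `GaldiLiouvilleGate`, item stmt-NavierStokesRegularity-0897)

For piece (C) (the limit equations (3.51)/(3.57)) of the assembly `step_construct_of_pieces`
(`SoloSalvageWu2026Construct.lean`) one needs, for every scale `R > 0`: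

* `isLerayProfile_blowDown` — (3.50) p.17 l.53–56: the blow-down `V_R = R^{2/3}v(R·)`,
  `P_R = R^{4/3}q(R·)` of a smooth steady solution `(v, q)` of the `ν`-system solves the steady
  system with viscosity `ν_R = ν R^{-1/3}` («−ν_j ΔV_j + (V_j·∇)V_j + ∇P_j = 0, ν_j = R_j^{-1/3} → 0»);
* the three tested identities of a smooth steady solution `(U, P)` with viscosity `μ` against
  compactly supported tests: momentum (`∫ ⟪U, DΦ·U⟫ + P div Φ = −μ ∫ ⟪U, ΔΦ⟫`,
  `integral_tested_momentum`), incompressibility (`∫ ⟪U, ∇φ⟫ = 0`, `integral_tested_divFree`),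
  and the local energy / Bernoulli identity (3.54)–(3.56)
  (`∫ Q ⟪U, ∇φ⟫ = μ ∫ φ|∇U|² − (μ/2) ∫ Δφ |U|²`, `Q = P + |U|²/2`, `integral_tested_bernoulli`),
  from the tree's whole-space integration by parts (`WholeSpaceIBP`, `ClassicalSolutionCalculus`)
  and Tsai's tested energy identity `IsLerayProfile.integral_mul_frobeniusNormSq_fderiv_eq`
  (`⟪w, ∇φ⟫ = Dφ w` is the tree's `inner_gradient_right_eq`, `…HarmonicCutoff`).

Theorems only, standard axioms, no `sorry`.

WHAT THIS IS NOT: not a proof of `Step_construct`; not a claim about NS regularity or blow-up; not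
a claim about any author beyond the typed locator.
-/

set_option linter.dupNamespace false

noncomputable section

open MeasureTheory Set Filter Topology InnerProductSpace
open scoped ENNReal NNReal Topology RealInnerProductSpace Laplacian ContDiff

namespace Summit.NavierStokesRegularity.NavierStokesRegularity.Theorems.Wu2026Salvage

open Literature.Analysis.FluidPDE Literature.Analysis.FunctionSpaces Literature.Claims.NS.Wu2026

/-! ## The steady system is insensitive to pressure constants -/

/-- Shifting the pressure by a constant preserves the steady system (p.14 l.29–43 «the original
pressure and p_can differ only by one constant»). [cite: Wu2026, (3.36) p.14 l.29–43] -/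
theorem isLerayProfile_sub_const {ν : ℝ} {v : E3 → E3} {p : E3 → ℝ} (h : IsLerayProfile ν 0 v p)
    (c : ℝ) : IsLerayProfile ν 0 v (fun x => p x - c) := by
  refine ⟨h.contDiff_velocity, h.contDiff_pressure.sub contDiff_const, fun y => ?_, h.divFree⟩
  have hg : gradient (fun x => p x - c) y = gradient p y := by
    simp only [gradient, fderiv_sub_const]
  rw [hg]
  exact h.profile_eq y

/-! ## (3.50): the blow-down solves the steady system with viscosity `ν R^{-1/3}` -/

/-- **(3.50)** (p.17 l.53–56 «The pair (V_j, P_j) satisfies −ν_jΔV_j + (V_j·∇)V_j + ∇P_j = 0,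
div V_j = 0, with ν_j = R_j^{−1/3} → 0»): for a smooth steady solution `(v, q)` of the `ν`-system
and `R > 0`, the blow-down `(R^{2/3}v(R·), R^{4/3}q(R·))` solves the steady system with viscosity
`ν R^{-1/3}` (every term of the system at `Ry` is multiplied by `R^{7/3}`). [cite: Wu2026, (3.50) p.17 l.53–56] -/
theorem isLerayProfile_blowDown {ν : ℝ} {v : E3 → E3} {q : E3 → ℝ} (hprof : IsLerayProfile ν 0 v q)
    {R : ℝ} (hR : 0 < R) :
    IsLerayProfile (ν * R ^ (-(1 : ℝ) / 3)) 0 (blowDown R v) (blowDownP R q) := by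
  have hR0 : R ≠ 0 := hR.ne'
  show IsLerayProfile (ν * R ^ (-(1 : ℝ) / 3)) 0 (fun w => R ^ ((2 : ℝ) / 3) • v (R • w))
    (fun w => R ^ ((4 : ℝ) / 3) * q (R • w))
  set a : ℝ := R ^ ((2 : ℝ) / 3) with ha
  set a' : ℝ := R ^ ((4 : ℝ) / 3) with ha'
  set c : ℝ := R ^ ((1 : ℝ) / 3) with hc
  have hc0 : 0 < c := Real.rpow_pos_of_pos hR _
  -- power bookkeeping: `R = c³`, `a = c²`, `a' = c⁴`, `R^{-1/3} = c⁻¹`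
  have hR3 : R = c ^ 3 := by
    rw [hc, ← Real.rpow_natCast, ← Real.rpow_mul hR.le]; norm_num
  have ha2 : a = c ^ 2 := by
    rw [ha, hc, ← Real.rpow_natCast, ← Real.rpow_mul hR.le]; norm_num
  have ha4 : a' = c ^ 4 := by
    rw [ha', hc, ← Real.rpow_natCast, ← Real.rpow_mul hR.le]; norm_num
  have hneg : R ^ (-(1 : ℝ) / 3) = c⁻¹ := by
    rw [hc, ← Real.rpow_neg_one, ← Real.rpow_mul hR.le]; norm_num
  have hfd : fderiv ℝ (fun w => a • v (R • w)) = fun z => (a * R) • fderiv ℝ v (R • z) :=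
    fderiv_const_smul_comp_smul v a hR0
  refine ⟨?_, ?_, fun y => ?_, fun y => ?_⟩
  · exact (hprof.contDiff_velocity.comp (contDiff_const_smul R)).const_smul a
  · exact contDiff_const.mul (hprof.contDiff_pressure.comp (contDiff_const_smul R))
  · have key := hprof.profile_eq (R • y)
    simp only [zero_smul, add_zero] at key ⊢
    have hΔ : (Δ fun w => a • v (R • w)) y = (a * R ^ 2) • (Δ v) (R • y) :=
      laplacian_const_smul_comp_smul v a hR0 y
    have hconv : convect (fun w => a • v (R • w)) (fun w => a • v (R • w)) y =
        (a * R * a) • convect v v (R • y) := by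
      simp only [convect_apply, hfd, FunLike.coe_smul, Pi.smul_apply, map_smul, smul_smul]
      congr 1
      ring
    have hPs : (fun w => a' * q (R • w)) = fun w => a' • q (R • w) := rfl
    have hgrad : gradient (fun w => a' * q (R • w)) y = (a' * R) • gradient q (R • y) := by
      rw [hPs, gradient, gradient, congrFun (fderiv_const_smul_comp_smul q a' hR0) y]
      simp
    rw [hΔ, hconv, hgrad, smul_smul]
    have e1 : ν * R ^ (-(1 : ℝ) / 3) * (a * R ^ 2) = c ^ 7 * ν := by
      rw [hneg, ha2, hR3]; field_simp
    have e2 : a * R * a = c ^ 7 := by rw [ha2, hR3]; ring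
    have e3 : a' * R = c ^ 7 := by rw [ha4, hR3]; ring
    rw [e1, e2, e3]
    have := congrArg (fun w => c ^ 7 • w) key
    simp only [smul_add, smul_neg, smul_smul, smul_zero] at this
    exact this
  · unfold VectorCalculus.divergence
    rw [congrFun hfd y, ContinuousLinearMap.toLinearMap_smul, map_smul, smul_eq_mul]
    have := hprof.divFree (R • y)
    unfold VectorCalculus.divergence at this
    rw [this, mul_zero]

/-- The blow-down of a `C^∞` field is `C^∞`. [cite: Wu2026, (3.19) p.10] -/
theorem contDiff_blowDown {v : E3 → E3} (hv : ContDiff ℝ ∞ v) (R : ℝ) :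
    ContDiff ℝ ∞ (blowDown R v) := by
  unfold blowDown
  exact (hv.comp (contDiff_const_smul R)).const_smul _

/-- The rescaled pressure of a `C^∞` pressure is `C^∞`. [cite: Wu2026, (3.38) p.14] -/
theorem contDiff_blowDownP {q : E3 → ℝ} (hq : ContDiff ℝ ∞ q) (R : ℝ) :
    ContDiff ℝ ∞ (blowDownP R q) := by
  unfold blowDownP
  exact contDiff_const.mul (hq.comp (contDiff_const_smul R))

/-- The gradient of the blow-down: `DV_R(y) = R^{5/3}·Dv(Ry)`, written `(R^{2/3}R) • Dv(Ry)`. [cite: Wu2026, (3.19) p.10] -/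
theorem fderiv_blowDown (v : E3 → E3) {R : ℝ} (hR : R ≠ 0) (y : E3) :
    fderiv ℝ (blowDown R v) y = (R ^ ((2 : ℝ) / 3) * R) • fderiv ℝ v (R • y) := by
  have h := fderiv_const_smul_comp_smul v (R ^ ((2 : ℝ) / 3)) hR
  exact congrFun h y

/-! ## Tested identities of a smooth steady solution -/

section Tested

variable {μ : ℝ} {U : E3 → E3} {P : E3 → ℝ}

/-- **The momentum equation tested against `Φ ∈ C²_c(ℝ³; ℝ³)`** (the weak form behind (3.51)
p.18 l.1–6): for a smooth steady solution with viscosity `μ`,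
`∫ (⟪U, DΦ·U⟫ + P div Φ) = −μ ∫ ⟪U, ΔΦ⟫` (Green twice, the trilinear identity with `div U = 0`,
and `∫⟪∇P, Φ⟫ = −∫ P div Φ`). [cite: Wu2026, (3.50)–(3.51) p.17–18] -/
theorem integral_tested_momentum (h : IsLerayProfile μ 0 U P) {Φ : E3 → E3}
    (hΦ : ContDiff ℝ 2 Φ) (hΦc : HasCompactSupport Φ) :
    ∫ y, (⟪U y, fderiv ℝ Φ y (U y)⟫ + P y * VectorCalculus.divergence Φ y) =
      -(μ * ∫ y, ⟪U y, (Δ Φ) y⟫) := by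
  have hU2 : ContDiff ℝ 2 U := h.contDiff_velocity
  have hU1 : ContDiff ℝ 1 U := hU2.of_le one_le_two
  have hP1 : ContDiff ℝ 1 P := h.contDiff_pressure
  have hΦ1 : ContDiff ℝ 1 Φ := hΦ.of_le one_le_two
  have hΦcts : Continuous Φ := hΦ.continuous
  have hDΦc : HasCompactSupport (fderiv ℝ Φ) := hΦc.fderiv (𝕜 := ℝ)
  have hdivc : HasCompactSupport (VectorCalculus.divergence Φ) :=
    HasCompactSupport.intro hΦc fun x hx => divergence_eq_zero_of_notMem_tsupport hx
  -- the three IBP identities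
  have iL : ∫ y, ⟪(Δ U) y, Φ y⟫ = ∫ y, ⟪U y, (Δ Φ) y⟫ := integral_inner_laplacian_comm hU2 hΦ hΦc
  have iC := integral_inner_convect_add_eq_zero hU1 hU1 hΦ1 hΦc
  have iG := integral_inner_gradient_eq_neg_integral_mul_divergence hP1 hΦ1 hΦc
  have hdiv0 : ∫ x, VectorCalculus.divergence U x * ⟪U x, Φ x⟫ = 0 := by
    simp [h.divFree _]
  rw [hdiv0, add_zero] at iC
  -- the system paired with `Φ`, integrated
  have hpt : ∀ y, -(μ * ⟪(Δ U) y, Φ y⟫) + ⟪convect U U y, Φ y⟫ + ⟪gradient P y, Φ y⟫ = 0 :=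
    fun y => by
    have hx := h.profile_eq y
    simp only [zero_smul, add_zero] at hx
    have := congrArg (fun w => ⟪w, Φ y⟫) hx
    simpa only [inner_add_left, inner_neg_left, inner_smul_left, inner_zero_left,
      RCLike.conj_to_real] using this
  have i1 : Integrable (fun y => ⟪(Δ U) y, Φ y⟫) :=
    integrable_inner_of_hasCompactSupport_right (continuous_laplacian hU2) hΦcts hΦc
  have i2 : Integrable (fun y => ⟪convect U U y, Φ y⟫) :=
    integrable_inner_of_hasCompactSupport_right
      ((hU1.continuous_fderiv one_ne_zero).clm_apply hU1.continuous) hΦcts hΦc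
  have i3 : Integrable (fun y => ⟪gradient P y, Φ y⟫) :=
    integrable_inner_of_hasCompactSupport_right (continuous_gradient_of_contDiff hP1) hΦcts hΦc
  have hsum : -(μ * ∫ y, ⟪(Δ U) y, Φ y⟫) + (∫ y, ⟪convect U U y, Φ y⟫) +
      ∫ y, ⟪gradient P y, Φ y⟫ = 0 := by
    have h0 : ∫ y, (-(μ * ⟪(Δ U) y, Φ y⟫) + ⟪convect U U y, Φ y⟫ + ⟪gradient P y, Φ y⟫) = 0 := by
      simp_rw [hpt]
      exact integral_zero E3 ℝ
    have i1' : Integrable (fun y => -(μ * ⟪(Δ U) y, Φ y⟫)) := (i1.const_mul μ).neg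
    have i12 : Integrable (fun y => -(μ * ⟪(Δ U) y, Φ y⟫) + ⟪convect U U y, Φ y⟫) := i1'.add i2
    rw [integral_add i12 i3, integral_add i1' i2, integral_neg, integral_const_mul] at h0
    exact h0
  -- the two integrands of the claim are integrable (compact support of `DΦ`, `div Φ`)
  have j1 : Integrable (fun y => ⟪U y, fderiv ℝ Φ y (U y)⟫) := by
    refine (hU1.continuous.inner ((hΦ1.continuous_fderiv one_ne_zero).clm_apply hU1.continuous))
      |>.integrable_of_hasCompactSupport (hDΦc.mono fun x hx => ?_)
    contrapose! hx
    simp only [Function.mem_support, ne_eq, not_not] at hx ⊢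
    simp [hx]
  have j2 : Integrable (fun y => P y * VectorCalculus.divergence Φ y) :=
    (hP1.continuous.mul (continuous_divergence (hΦ1.continuous_fderiv one_ne_zero)))
      |>.integrable_of_hasCompactSupport hdivc.mul_left
  rw [integral_add j1 j2]
  have hconv : ∫ y, ⟪U y, convect U Φ y⟫ = ∫ y, ⟪U y, fderiv ℝ Φ y (U y)⟫ := by
    simp only [convect_apply]
  rw [hconv] at iC
  rw [iL] at hsum
  linarith

/-- **Incompressibility tested against `φ ∈ C¹_c`**: `∫ ⟪U, ∇φ⟫ = 0` for a `C¹` divergence-free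
field (the weak form `div V_j = 0` of (3.50)/(3.51)). [cite: Wu2026, (3.50)–(3.51) p.17–18] -/
theorem integral_tested_divFree (hU : ContDiff ℝ 1 U) (hdiv : VectorCalculus.IsDivFree U)
    {φ : E3 → ℝ} (hφ : ContDiff ℝ 1 φ) (hφc : HasCompactSupport φ) :
    ∫ y, ⟪U y, gradient φ y⟫ = 0 := by
  have h := integral_mul_divergence_add_eq_zero_left hφ hU hφc
  have h0 : ∫ x, φ x * VectorCalculus.divergence U x = 0 := by simp [hdiv _]
  rw [h0, zero_add] at h
  exact h

/-- **The local energy identity tested, (3.54)–(3.56)** (p.18 l.32 – p.19 l.70: «−ν_jΔ(|V_j|²/2) +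
ν_j|∇V_j|² + div(Q_jV_j) = 0» paired with `φ`): for a smooth steady solution `(U, P)` with
viscosity `μ` and `φ ∈ C²_c`, `∫ Q ⟪U, ∇φ⟫ = μ ∫ φ |∇U|² − (μ/2) ∫ Δφ |U|²`, `Q = P + |U|²/2`
(from the tree's tested energy identity `IsLerayProfile.integral_mul_frobeniusNormSq_fderiv_eq`).
[cite: Wu2026, (3.54)–(3.56) p.18–19] -/
theorem integral_tested_bernoulli (h : IsLerayProfile μ 0 U P) (hU : ContDiff ℝ ∞ U)
    {φ : E3 → ℝ} (hφ : ContDiff ℝ 2 φ) (hφc : HasCompactSupport φ) :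
    ∫ y, ⟪bern U P y • U y, gradient φ y⟫ =
      μ * (∫ y, φ y * frobeniusNormSq (fderiv ℝ U y)) -
        (μ / 2) * ∫ y, (Δ φ) y * ‖U y‖ ^ 2 := by
  have hE := h.integral_mul_frobeniusNormSq_fderiv_eq hU hφ hφc 0
  simp only [zero_div, zero_mul, add_zero, sub_zero] at hE
  have hφ1 : ContDiff ℝ 1 φ := hφ.of_le one_le_two
  have hUc : Continuous U := hU.continuous
  have hP1 : ContDiff ℝ 1 P := h.contDiff_pressure
  have hDφc : HasCompactSupport (fderiv ℝ φ) := hφc.fderiv (𝕜 := ℝ)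
  -- split the Bernoulli pairing
  have hsplit : ∀ y, ⟪bern U P y • U y, gradient φ y⟫ =
      P y * ⟪U y, gradient φ y⟫ + (1 / 2) * (fderiv ℝ φ y (U y) * ‖U y‖ ^ 2) := fun y => by
    rw [real_inner_smul_left, bern, inner_gradient_right_eq]
    ring
  have k1 : Integrable (fun y => P y * ⟪U y, gradient φ y⟫) := by
    refine (hP1.continuous.mul (hUc.inner (continuous_gradient_of_contDiff hφ1)))
      |>.integrable_of_hasCompactSupport ?_
    refine (hDφc.mono fun x hx => ?_).mul_left
    contrapose! hx
    simp only [Function.mem_support, ne_eq, not_not] at hx ⊢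
    simp [gradient, hx]
  have k2 : Integrable (fun y => fderiv ℝ φ y (U y) * ‖U y‖ ^ 2) := by
    refine (((hφ1.continuous_fderiv one_ne_zero).clm_apply hUc).mul (hUc.norm.pow 2))
      |>.integrable_of_hasCompactSupport ?_
    refine (hDφc.mono fun x hx => ?_).mul_right
    contrapose! hx
    simp only [Function.mem_support, ne_eq, not_not] at hx ⊢
    simp [hx]
  simp_rw [hsplit]
  rw [integral_add k1 (k2.const_mul _), integral_const_mul]
  linarith

end Tested

end Summit.NavierStokesRegularity.NavierStokesRegularity.Theorems.Wu2026Salvage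

end

-- WHAT THIS IS NOT: not a claim about NS regularity or blow-up; not a claim about any author beyond the typed locator.
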